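import Mathlib
import Literature.Probability.LatticeModels.GKSInequalities
import Summits.CriticalPhenomena.Ising3DConformalLimit.Theorems.PrecisionLaplacianInverseMFerromagnetImOfImDeg3
import Summits.CriticalPhenomena.Ising3DConformalLimit.Theorems.PrecisionLaplacianInverseMFerromagnetWheel
import HarnessLib

/-!
# Crux `PrecisionLaplacian.InverseMFerromagnet` (stmt-CriticalPhenomena-4798), line `Sketch` —
# Theorem W at the boundary: wheels with NONNEGATIVE couplings (stub `helper_im_wheel_nonneg`, wave 2, lead c6)
-/

namespace Summit.CriticalPhenomena.Ising3DConformalLimit.Cruxes.InverseMFerromagnet.PartialCovarianceLadder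

open Literature.Probability.LatticeModels Finset Matrix Filter Topology

noncomputable section

/-- The unnormalised expectation `Z⟨f⟩` is continuous in the coupling vector (a finite sum of exponentials of
linear forms). [folklore] -/
theorem wnn_continuous_gksSum {Λ' ι : Type*} [Fintype Λ'] [DecidableEq Λ'] (s : Finset ι) (C : ι → Finset Λ')
    (f : SpinConfig Λ' → ℝ) : Continuous fun K : ι → ℝ => gksSum s K C f := by
  -- adapted from `Literature.Barriers.CriticalPhenomena.LongRangeIsing.continuous_gksSum`
  unfold gksSum gksWeight gksHamiltonian
  refine continuous_finsetSum _ fun ω _ => continuous_const.mul (Real.continuous_exp.comp ?_)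
  exact continuous_finsetSum _ fun i _ => (continuous_apply i).mul continuous_const

/-- The expectation `⟨f⟩_K` is continuous in the coupling vector `K` (ratio of two continuous functions with a
positive denominator `Z_K > 0`). [folklore] -/
theorem wnn_continuous_gksExpect {Λ' ι : Type*} [Fintype Λ'] [DecidableEq Λ'] (s : Finset ι) (C : ι → Finset Λ')
    (f : SpinConfig Λ' → ℝ) : Continuous fun K : ι → ℝ => gksExpect s K C f :=
  (wnn_continuous_gksSum s C f).div (wnn_continuous_gksSum s C fun _ => 1) fun K => (gksSum_one_pos s K C).ne'

/-- Closedness of the sign condition along a continuous nonsingular matrix family: if `ε ↦ S ε` is continuous with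
`det (S ε) ≠ 0` for all `ε` and `(S ε)⁻¹ x y ≤ 0` for all `ε > 0`, then `(S 0)⁻¹ x y ≤ 0` (the entries of the
inverse, `adjugate / det`, are continuous). [folklore] -/
theorem wnn_inv_entry_nonpos_of_pos {m : Type*} [Fintype m] [DecidableEq m] (S : ℝ → Matrix m m ℝ)
    (hS : Continuous S) (hdet : ∀ ε, (S ε).det ≠ 0) (x y : m) (hpos : ∀ ε : ℝ, 0 < ε → (S ε)⁻¹ x y ≤ 0) :
    (S 0)⁻¹ x y ≤ 0 := by
  have hf : Continuous fun ε => (S ε)⁻¹ x y := by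
    have he : (fun ε => (S ε)⁻¹ x y) = fun ε => ((S ε).det)⁻¹ * (S ε).adjugate x y := by
      funext ε
      rw [Matrix.inv_def, Ring.inverse_eq_inv, Matrix.smul_apply, smul_eq_mul]
    rw [he]
    exact (hS.matrix_det.inv₀ hdet).mul (hS.matrix_adjugate.matrix_elem x y)
  exact le_of_tendsto (tendsto_nhdsWithin_of_tendsto_nhds (s := Set.Ioi 0) (hf.tendsto 0))
    (eventually_nhdsWithin_of_forall fun ε hε => hpos ε hε)

/-- Shifting all couplings of a wheel by `ε` commutes with `Fin.append`. [folklore] -/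
theorem wnn_append_add {n : ℕ} (K h : Fin n → ℝ) (ε : ℝ) :
    Fin.append (fun k => K k + ε) (fun k => h k + ε) = fun i => Fin.append K h i + ε := by
  funext i
  induction i using Fin.addCases with
  | left k => simp only [Fin.append_left]
  | right k => simp only [Fin.append_right]

/-- **Theorem W at the boundary (lead c6, wave 2 stub): wheels with NONNEGATIVE couplings.**  The inverse-M property of
`helper_im_wheel` (strictly positive couplings) extends to all `K, h ≥ 0` (missing spokes / rim bonds allowed) by continuity of
the inverse second-moment matrix in the couplings (`ε ↦ (K + ε, h + ε)`, `ε → 0⁺`); in particular IM for every once-rim-subdivided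
wheel, i.e. DB♯ on every RIM bond of every wheel. [folklore] -/
theorem helper_im_wheel_nonneg :
    ∀ (n : ℕ), 3 ≤ n → ∀ (K h : Fin n → ℝ), (∀ k, 0 ≤ K k) → (∀ k, 0 ≤ h k) →
      ∀ x y : Fin (n + 1), x ≠ y →
        (Matrix.of fun p q : Fin (n + 1) =>
          gksExpect Finset.univ (Fin.append K h)
            (Fin.append (fun k : Fin n => ({k.castSucc, (finRotate n k).castSucc} : Finset (Fin (n + 1))))
              (fun k : Fin n => ({Fin.last n, k.castSucc} : Finset (Fin (n + 1)))))
            (fun ω => spinAt p ω * spinAt q ω))⁻¹ x y ≤ 0 := by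
  intro n hn K h hK hh x y hxy
  obtain ⟨S, hS⟩ : ∃ S : ℝ → Matrix (Fin (n + 1)) (Fin (n + 1)) ℝ, ∀ ε, S ε =
      Matrix.of fun p q : Fin (n + 1) =>
        gksExpect Finset.univ (fun i => Fin.append K h i + ε)
          (Fin.append (fun k : Fin n => ({k.castSucc, (finRotate n k).castSucc} : Finset (Fin (n + 1))))
            (fun k : Fin n => ({Fin.last n, k.castSucc} : Finset (Fin (n + 1)))))
          (fun ω => spinAt p ω * spinAt q ω) := ⟨_, fun ε => rfl⟩
  have hSc : Continuous S := by
    refine continuous_matrix fun p q => ?_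
    simp only [hS, Matrix.of_apply]
    exact (wnn_continuous_gksExpect Finset.univ _ _).comp
      (continuous_pi fun i => continuous_const.add continuous_id)
  have hdet : ∀ ε, (S ε).det ≠ 0 := fun ε => by
    rw [hS]
    exact (c5_posDef Finset.univ _ _).det_pos.ne'
  have hpos : ∀ ε : ℝ, 0 < ε → (S ε)⁻¹ x y ≤ 0 := by
    intro ε hε
    have key := helper_im_wheel n hn (fun k => K k + ε) (fun k => h k + ε)
      (fun k => add_pos_of_nonneg_of_pos (hK k) hε) (fun k => add_pos_of_nonneg_of_pos (hh k) hε) x y hxy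
    rw [wnn_append_add K h ε] at key
    rw [hS]
    exact key
  have main := wnn_inv_entry_nonpos_of_pos S hSc hdet x y hpos
  rw [hS 0] at main
  simpa using main

end

end Summit.CriticalPhenomena.Ising3DConformalLimit.Cruxes.InverseMFerromagnet.PartialCovarianceLadder
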